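import Summits.QuantumFields.YangMills.Theses.LangevinControlUV
import Summits.QuantumFields.YangMills.Theorems.LangevinControlUVLatticeGapInUVUnitsGapToClustering
import Summits.QuantumFields.YangMills.Theorems.LangevinControlUVLatticeGapInUVUnitsSpectralToolkit
import Summits.QuantumFields.YangMills.Theorems.LangevinControlUVLatticeGapInUVUnitsLightCone
import Summits.QuantumFields.YangMills.Theorems.LangevinControlUVLatticeGapInUVUnitsCStubRatioSeed
import Summits.QuantumFields.YangMills.Theorems.LangevinControlUVLatticeGapInUVUnitsCStubRatioBound
import Literature.MathematicalPhysics.QuantumLattice.WilsonBlockHeatBath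

/-!
# Skeleton — crux `LatticeGapInUVUnitsC` (stmt-QuantumFields-16206), line `Sketch` (idea `amplitude-exhaustion-ratchet`)

Line lead prover-line-stmt-QuantumFields-16206-0, 2026-08-16.  Reshaped from the ideator's `IdeasSketch_r1_i1.lean`
(same composition idea; RESHAPE v2, the card's `U = 1` fallback `ratioAmp`) into registered, DEF-FREE stubs over
the self-normalised, reflection-positive axis ratio

  `v(β, k) := Cov_{β,(ℤ/16k)⁴}(P_0^{01}, P_{2k e₂}^{01}) / Cov_{β,(ℤ/16k)⁴}(P_0^{01}, P_{k e₂}^{01})`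

(the package's axis observable at the two largest separations it pins, `L/8 = 2k` and `L/16 = k`, read on the torus of
side `L = 16k` itself; `≈ 2⁻⁸ Γ(2s)/Γ(s)`, `s = k a(β)`, while femto; `→ 0` like `e^{−m k a}` when massive).

WHY v2: wave 1 found that the absolute amplitude's BOUND stub (`N⁸ Cov ≤ U` beyond the femto edge, β-uniform) is
hyperscaling ∧ infrared decay — an open statement NOT implied even by the crux (O(1) prefactors); for the ratio the
bound is a THEOREM: `0 ≤ Cov(P_0, P_{2k e₂}) ≤ Cov(P_0, P_{k e₂})` on every torus `16k`, every `β ≥ 0` (tree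
`axisPlaquetteCov_nonneg` / `axisPlaquetteCov_antitone`, reflection positivity p-landed for crux 9363), so `v ≤ 1`.

* S1 `stub_ratioSeed`      — `v ≥ vmin := c·m/(2⁸ C) > 0` on the top femto octave `ℓ₀/32 ≤ k a(β) ≤ ℓ₀/16` (package
                              TWO-sidedness + interval pinning `m ≤ Γ` on `[ℓ₀/16, ℓ₀/8]` for CONTINUOUS rulers; provable).
* S2 `stub_ratioBound`     — `v ≤ 1` for all `β ≥ 0`, all `k` (RP monotonicity; provable).
* S4 `stub_ratioDichotomy` — windowed grow-or-certify: for `β ≥ β₂` and `k` at or beyond the femto edge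
                              (`ℓ₀ ≤ 32 k a β`), over `M` octaves `v` grows by `1 + δ`, or the Knabe certificate fires:
                              `GlobalPoincare` of the overlapping block heat bath at nominal cell `16·2^M k` (the side of
                              the torus on which the stalled ratio was read), constant `γ`, on all tori `S ≥ K·16·2^M k`
                              (open physics, the line's ONE bet: no approximately conformal, non-mixing plateau of the
                              effective exponent of the curvature two-point function at scales ≥ ℓ₀/32).
* R5 (certificate ⇒ clustering) is NOT a stub: it is the LANDED Knabe pipeline `stub_gapToClustering`
  (p90222) fed with `stub_spectralToolkit.2` (p90500) and `stub_lightCone` (p80165), imported.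
* (v1's `stub_seed` for the absolute amplitude LANDED as p122527 `…Theorems.LatticeGapInUVUnitsC.AmplitudeRatchet.stub_seed`;
  it is not used by v2.)

Composition (sorry-free): `exhaustion` (a quantity seeded at `vmin`, bounded by `1`, growing by `1+δ` per window unless
certified, is certified within `J = ⌈log(1/vmin)/log(1+δ)⌉` windows) along the ladder `k_j(β) = 2^{Mj} ⌊ℓ₀/(16 a β)⌋`, so
the certificate fires at a cell `≤ 2^{MJ} ℓ₀/a(β)` with `J` INDEPENDENT of `β`; the pipeline then clusters every species
pair at rate `ρ n/cell ≥ (ρ/(2^{MJ} ℓ₀)) · a(β) · n`.  `LatticeGapInUVUnitsC_of` concludes the crux BY NAME; its only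
`sorry` is S4 `stub_ratioDichotomy` (S1, S2 are discharged by the landed tree theorems).

STATUS (lead cycle 1, 2026-08-16): S1 LANDED p122959, S2 LANDED p122942, the def-free composition LANDED p123289
(`Theorems/LangevinControlUVLatticeGapInUVUnitsCRatchetReduction.lean`: `latticeGapInUVUnitsC_of_ratchet : S1-sig → S2-sig →
S4-sig → LatticeGapInUVUnitsC`, `ratioDichotomy_of_globalCertificate`, `latticeGapInUVUnitsC_of_globalCertificate`).  CLOSING
RECIPE: when `stub_ratioDichotomy` lands as a theorem `T` (verbatim signature, gen/sig_stub_ratioDichotomy.txt on the lead's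
folder = the registered stub), the crux closes with the 3-line file
`theorem LatticeGapInUVUnitsC_holds : LatticeGapInUVUnitsC := latticeGapInUVUnitsC_of_ratchet stub_ratioSeed stub_ratioBound T`
(`--workitem stmt-QuantumFields-16206`).
-/

open scoped BigOperators
open MeasureTheory Filter Topology
open Literature.MathematicalPhysics.QuantumFieldTheory Literature.MathematicalPhysics.QuantumLattice
open Literature.MathematicalPhysics.QuantumLattice.WilsonBlockHeatBath
open Summit.QuantumFields.YangMills.Theses.LangevinControlUV

noncomputable section

namespace Summit.QuantumFields.YangMills.Cruxes.LatticeGapInUVUnitsC.AmplitudeRatchet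

/-! ## §1 Exhaustion of a bounded quantity under a grow-or-certify dichotomy (pure bookkeeping, proved) -/

/-- **Exhaustion lemma.** A real sequence seeded at `u 0 ≥ umin`, bounded by `U` up to index `J`, which at every
step `j < J` either grows by the factor `1 + δ` or triggers `P (j+1)`, triggers `P` at some index `1 ≤ j ≤ J` as soon
as `(1+δ)^J · umin > U`. -/
theorem exhaustion {u : ℕ → ℝ} {P : ℕ → Prop} {umin U δ : ℝ} {J : ℕ} (hδ : 0 ≤ δ)
    (h0 : umin ≤ u 0) (hbound : ∀ j, j ≤ J → u j ≤ U)
    (hdich : ∀ j, j < J → (1 + δ) * u j ≤ u (j + 1) ∨ P (j + 1))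
    (hJ : U < (1 + δ) ^ J * umin) :
    ∃ j, 1 ≤ j ∧ j ≤ J ∧ P j := by
  by_contra hno
  push Not at hno
  have hgrow : ∀ j, j ≤ J → (1 + δ) ^ j * umin ≤ u j := by
    intro j
    induction j with
    | zero => intro _; simpa using h0
    | succ k ih =>
      intro hk
      have hk' : k < J := Nat.lt_of_succ_le hk
      rcases hdich k hk' with hle | hP
      · calc (1 + δ) ^ (k + 1) * umin = (1 + δ) * ((1 + δ) ^ k * umin) := by ring
          _ ≤ (1 + δ) * u k := mul_le_mul_of_nonneg_left (ih hk'.le) (by linarith)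
          _ ≤ u (k + 1) := hle
      · exact absurd hP (hno (k + 1) (Nat.succ_le_succ (Nat.zero_le k)) hk)
  have h1 := hgrow J le_rfl
  have h2 := hbound J le_rfl
  linarith

/-- A window count `J` with `(1+δ)^J · umin > U` exists for every `umin > 0`, `δ > 0`. -/
theorem exists_window_count {umin δ : ℝ} (U : ℝ) (hmin : 0 < umin) (hδ : 0 < δ) :
    ∃ J : ℕ, U < (1 + δ) ^ J * umin := by
  obtain ⟨J, hJ⟩ := pow_unbounded_of_one_lt (U / umin) (by linarith : (1 : ℝ) < 1 + δ)
  exact ⟨J, by rwa [div_lt_iff₀ hmin] at hJ⟩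

/-! ## §2 The generic ratchet reduction: seed ∧ bound ∧ dichotomy ∧ certificate pipeline ⇒ `Concl` (proved) -/

variable {G : Type} [Group G] [TopologicalSpace G] [IsTopologicalGroup G] [CompactSpace G]
  [MeasurableSpace G] [BorelSpace G]

/-- **`Concl` from an amplitude ratchet** (generic in the amplitude `amp β N` and the certificate `Cert β b`).
For `β ≥ β₂`: a scale `N₀ β ≥ 1` with `N₀ β · a β ≤ ℓ`; SEED `amp β (N₀ β) ≥ umin`; BOUND `amp β (2^{Mj} N₀ β) ≤ U`
(`j ≤ J`); DICHOTOMY (`j < J`): growth by `1+δ` over the window or `Cert` at the new scale; PIPELINE: `Cert β b` clusters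
every species pair at rate `c/b` on tori `S ≥ K b` with pair-dependent constants; COUNT `(1+δ)^J umin > U`.  Then the
crux's conclusion holds with `c₁ = c/(2^{MJ} ℓ)` and `S₁ β = ⌈K⌉ 2^{MJ} N₀ β`. -/
theorem concl_of_ratchet (r : LatticeRep G) {a : ℝ → ℝ} (hpos : ∀ β, 0 < a β)
    (amp : ℝ → ℕ → ℝ) (Cert : ℝ → ℕ → Prop)
    {ℓ β₂ umin U δ c K : ℝ} (hδ : 0 ≤ δ) (hc : 0 < c) (hℓ : 0 < ℓ)
    (N₀ : ℝ → ℕ) (hN₀pos : ∀ β, β₂ ≤ β → 1 ≤ N₀ β) (hN₀ : ∀ β, β₂ ≤ β → (N₀ β : ℝ) * a β ≤ ℓ)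
    (M J : ℕ) (hJ : U < (1 + δ) ^ J * umin)
    (hseed : ∀ β, β₂ ≤ β → umin ≤ amp β (N₀ β))
    (hbound : ∀ β, β₂ ≤ β → ∀ j : ℕ, j ≤ J → amp β (2 ^ (M * j) * N₀ β) ≤ U)
    (hdich : ∀ β, β₂ ≤ β → ∀ j : ℕ, j < J →
      (1 + δ) * amp β (2 ^ (M * j) * N₀ β) ≤ amp β (2 ^ (M * (j + 1)) * N₀ β) ∨
        Cert β (2 ^ (M * (j + 1)) * N₀ β))
    (hcert : ∀ A B : YMSpecies G, ∃ C : ℝ, ∀ β : ℝ, β₂ ≤ β → ∀ b : ℕ, 1 ≤ b → Cert β b →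
      ∀ S n : ℕ, K * b ≤ S → n ≤ S →
        |latticeConnectedCorr r.ρ β (2 * S + 1) A.F B.F n| ≤ C * Real.exp (-(c * n / b))) :
    ∃ (c₁ β₂' : ℝ) (S₁ : ℝ → ℕ), 0 < c₁ ∧ ∀ A B : YMSpecies G, ∃ C : ℝ, ∀ β : ℝ, β₂' ≤ β → ∀ S n : ℕ,
      S₁ β ≤ S → n ≤ S →
        |latticeConnectedCorr r.ρ β (2 * S + 1) A.F B.F n| ≤ C * Real.exp (-(c₁ * a β * n)) := by
  set T : ℕ := 2 ^ (M * J) with hT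
  have hTpos : (0 : ℝ) < T := by positivity
  refine ⟨c / (T * ℓ), β₂, fun β => ⌈K⌉₊ * (T * N₀ β), by positivity, fun A B => ?_⟩
  obtain ⟨C, hC⟩ := hcert A B
  refine ⟨max C 0, fun β hβ S n hS hn => ?_⟩
  obtain ⟨j, -, hjJ, hPj⟩ := exhaustion (u := fun j => amp β (2 ^ (M * j) * N₀ β))
    (P := fun j => Cert β (2 ^ (M * j) * N₀ β)) hδ (by simpa using hseed β hβ) (hbound β hβ)
    (hdich β hβ) hJ
  set b : ℕ := 2 ^ (M * j) * N₀ β with hb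
  have hN₀1 : 1 ≤ N₀ β := hN₀pos β hβ
  have hb1 : 1 ≤ b := by
    have : 1 ≤ 2 ^ (M * j) := Nat.one_le_two_pow
    calc 1 = 1 * 1 := by ring
      _ ≤ 2 ^ (M * j) * N₀ β := Nat.mul_le_mul this hN₀1
  have hbT : b ≤ T * N₀ β := by
    have : 2 ^ (M * j) ≤ 2 ^ (M * J) := Nat.pow_le_pow_right (by norm_num) (Nat.mul_le_mul_left M hjJ)
    exact Nat.mul_le_mul_right (N₀ β) this
  have hKb : K * (b : ℝ) ≤ S := by
    have h1 : K * (b : ℝ) ≤ (⌈K⌉₊ : ℝ) * ((T * N₀ β : ℕ) : ℝ) := by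
      rcases le_or_gt 0 K with hK | hK
      · exact mul_le_mul (Nat.le_ceil K) (by exact_mod_cast hbT) (by positivity) (by positivity)
      · exact (mul_nonpos_of_nonpos_of_nonneg hK.le (by positivity)).trans (by positivity)
    have h2 : ((⌈K⌉₊ : ℝ) * ((T * N₀ β : ℕ) : ℝ)) = ((⌈K⌉₊ * (T * N₀ β) : ℕ) : ℝ) := by push_cast; ring
    rw [h2] at h1
    exact h1.trans (by exact_mod_cast hS)
  have hcorr := hC β hβ b hb1 hPj S n hKb hn
  refine hcorr.trans ?_
  have hbpos : (0 : ℝ) < b := by exact_mod_cast hb1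
  have hba : (b : ℝ) * a β ≤ T * ℓ := by
    have h1 : (b : ℝ) * a β ≤ ((T * N₀ β : ℕ) : ℝ) * a β :=
      mul_le_mul_of_nonneg_right (by exact_mod_cast hbT) (hpos β).le
    have h2 : ((T * N₀ β : ℕ) : ℝ) * a β = (T : ℝ) * ((N₀ β : ℝ) * a β) := by push_cast; ring
    rw [h2] at h1
    exact h1.trans (mul_le_mul_of_nonneg_left (hN₀ β hβ) hTpos.le)
  have key : c / (T * ℓ) * a β * n ≤ c * n / b := by
    rw [le_div_iff₀ hbpos]
    have e : c / (T * ℓ) * a β * n * b = c * n * ((b : ℝ) * a β) / (T * ℓ) := by ring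
    rw [e, div_le_iff₀ (by positivity : (0 : ℝ) < T * ℓ)]
    exact mul_le_mul_of_nonneg_left hba (by positivity)
  calc C * Real.exp (-(c * n / b)) ≤ max C 0 * Real.exp (-(c * n / b)) :=
        mul_le_mul_of_nonneg_right (le_max_left _ _) (Real.exp_pos _).le
    _ ≤ max C 0 * Real.exp (-(c / (T * ℓ) * a β * n)) :=
        mul_le_mul_of_nonneg_left (Real.exp_le_exp.2 (neg_le_neg key)) (le_max_right _ _)

/-! ## §3 The ratchet quantity as a total function, and its bridge to the explicit signatures -/

/-- `axisRatio r β k = Cov_{β,16k}(P_0, P_{2k e₂}) / Cov_{β,16k}(P_0, P_{k e₂})` for `k ≥ 1` (torus `(ℤ/16k)⁴`, plaquette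
costs `P_x = N_r − Re tr r.ρ(U_{x,01})`), and `0` at `k = 0`. -/
def axisRatio (r : LatticeRep G) (β : ℝ) (k : ℕ) : ℝ :=
  if hk : k = 0 then 0 else
    haveI : NeZero (16 * k) := ⟨by omega⟩
    (wilsonExpectation r.ρ β (fun U : GaugeConfig 4 (16 * k) G => ((r.N : ℝ) - (r.ρ (plaquetteHolonomy U 0 0 1)).trace.re) * ((r.N : ℝ) - (r.ρ (plaquetteHolonomy U (Pi.single (2 : Fin 4) (((2 * k) : ℕ) : ZMod (16 * k))) 0 1)).trace.re)) - wilsonExpectation r.ρ β (fun U : GaugeConfig 4 (16 * k) G => (r.N : ℝ) - (r.ρ (plaquetteHolonomy U 0 0 1)).trace.re) * wilsonExpectation r.ρ β (fun U : GaugeConfig 4 (16 * k) G => (r.N : ℝ) - (r.ρ (plaquetteHolonomy U (Pi.single (2 : Fin 4) (((2 * k) : ℕ) : ZMod (16 * k))) 0 1)).trace.re)) / (wilsonExpectation r.ρ β (fun U : GaugeConfig 4 (16 * k) G => ((r.N : ℝ) - (r.ρ (plaquetteHolonomy U 0 0 1)).trace.re) * ((r.N : ℝ) - (r.ρ (plaquetteHolonomy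 U (Pi.single (2 : Fin 4) ((k : ℕ) : ZMod (16 * k))) 0 1)).trace.re)) - wilsonExpectation r.ρ β (fun U : GaugeConfig 4 (16 * k) G => (r.N : ℝ) - (r.ρ (plaquetteHolonomy U 0 0 1)).trace.re) * wilsonExpectation r.ρ β (fun U : GaugeConfig 4 (16 * k) G => (r.N : ℝ) - (r.ρ (plaquetteHolonomy U (Pi.single (2 : Fin 4) ((k : ℕ) : ZMod (16 * k))) 0 1)).trace.re))

/-- The bridge: for `k ≠ 0` the total function is the explicit ratio of the stub signatures. -/
theorem axisRatio_eq (r : LatticeRep G) (β : ℝ) (k : ℕ) [NeZero (16 * k)] (hk : k ≠ 0) :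
    axisRatio r β k = (wilsonExpectation r.ρ β (fun U : GaugeConfig 4 (16 * k) G => ((r.N : ℝ) - (r.ρ (plaquetteHolonomy U 0 0 1)).trace.re) * ((r.N : ℝ) - (r.ρ (plaquetteHolonomy U (Pi.single (2 : Fin 4) (((2 * k) : ℕ) : ZMod (16 * k))) 0 1)).trace.re)) - wilsonExpectation r.ρ β (fun U : GaugeConfig 4 (16 * k) G => (r.N : ℝ) - (r.ρ (plaquetteHolonomy U 0 0 1)).trace.re) * wilsonExpectation r.ρ β (fun U : GaugeConfig 4 (16 * k) G => (r.N : ℝ) - (r.ρ (plaquetteHolonomy U (Pi.single (2 : Fin 4) (((2 * k) : ℕ) : ZMod (16 * k))) 0 1)).trace.re)) / (wilsonExpectation r.ρ β (fun U : GaugeConfig 4 (16 * k) G => ((r.N : ℝ) - (r.ρ (plaquetteHolonomy U 0 0 1)).trace.re) * ((r.N : ℝ) - (r.ρ (plaquetteHolonomy U (Pi.single (2 : Fin 4) ((k : ℕ) : ZMod (16 * k))) 0 1)).trace.re)) - wilsonExpectation r.ρ β (fun U : GaugeConfig 4 (16 * k) G => (r.N : ℝ) - (r.ρ (plaquetteHolonomy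 U 0 0 1)).trace.re) * wilsonExpectation r.ρ β (fun U : GaugeConfig 4 (16 * k) G => (r.N : ℝ) - (r.ρ (plaquetteHolonomy U (Pi.single (2 : Fin 4) ((k : ℕ) : ZMod (16 * k))) 0 1)).trace.re)) := by
  unfold axisRatio
  rw [dif_neg hk]

/-! ## §4 Registered stubs (def-free signatures in tree vocabulary) -/

/-- **Stub S1 — SEED** — LANDED p122959 (`Theorems/LangevinControlUVLatticeGapInUVUnitsCStubRatioSeed.lean`). (Bookkeeping; the one place the package's LOWER bound does infrared work).  For a
CONTINUOUS unit map carrying the femto two-point package, on the top femto octave `ℓ₀/32 ≤ k a(β) ≤ ℓ₀/16` of the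
torus `16k` the ratio is `≥ vmin = c·m/(2⁸·C) > 0` for all `β ≥ β₀`: lower clause at `n = 2k`, upper clause at `n = k`
(`Γ ≤ 1`, and `C ≥ c > 0` from the same box), `m ≤ Γ` on `[ℓ₀/16, ℓ₀/8]` by `pinning_of_femtoBox`. -/
theorem stub_ratioSeed : ∀ (G : Type) [Group G] [TopologicalSpace G] [IsTopologicalGroup G] [CompactSpace G] [MeasurableSpace G] [BorelSpace G] (r : LatticeRep G) (a Γ : ℝ → ℝ) (β₀ ℓ₀ c C : ℝ), Continuous a → 0 < ℓ₀ → 0 < c → (∀ β, 0 < a β) → Filter.Tendsto a Filter.atTop (nhds 0) → (∀ s : ℝ, 0 < s → s ≤ ℓ₀ → 0 < Γ s ∧ Γ s ≤ 1) → (∀ (L : ℕ) [NeZero L] (β : ℝ), β₀ ≤ β → (L : ℝ) * a β ≤ ℓ₀ → let P : (Fin 4 → ZMod L) → Fin 4 → Fin 4 → GaugeConfig 4 L G → ℝ := fun x i j U => (r.N : ℝ) - (r.ρ (plaquetteHolonomy U x i j)).trace.re; let E : (GaugeConfig 4 L G → ℝ) → ℝ := fun F => wilsonExpectation (d := 4)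 (L := L) r.ρ β F; let cov : (GaugeConfig 4 L G → ℝ) → (GaugeConfig 4 L G → ℝ) → ℝ := fun F F' => E (fun U => F U * F' U) - E F * E F'; let dist : (Fin 4 → ZMod L) → (Fin 4 → ZMod L) → ℝ := fun x y => Real.sqrt (∑ k : Fin 4, (((x k - y k).valMinAbs : ℤ) : ℝ) ^ 2); (∀ n : ℕ, 1 ≤ n → 8 * n ≤ L → c * Γ ((n : ℝ) * a β) ≤ (n : ℝ) ^ 8 * cov (P 0 0 1) (P (Pi.single (2 : Fin 4) ((n : ℕ) : ZMod L)) 0 1) ∧ (n : ℝ) ^ 8 * cov (P 0 0 1) (P (Pi.single (2 : Fin 4) ((n : ℕ) : ZMod L)) 0 1) ≤ C * Γ ((n : ℝ) * a β)) ∧ (∀ (x y : Fin 4 → ZMod L) (i j i' j' : Fin 4), x ≠ y → i ≠ j → i' ≠ j' → |cov (P x i j) (P y i' j')| * dist x y ^ 8 ≤ C * Γ (dist x y * a β))) → ∃ vmin : ℝ, 0 < vmin ∧ ∀ β : ℝ, β₀ ≤ β → ∀ (k : ℕ) [NeZero (16 * k)], ℓ₀ ≤ 32 * ((k : ℝ)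 * a β) → 16 * ((k : ℝ) * a β) ≤ ℓ₀ → vmin ≤ (wilsonExpectation r.ρ β (fun U : GaugeConfig 4 (16 * k) G => ((r.N : ℝ) - (r.ρ (plaquetteHolonomy U 0 0 1)).trace.re) * ((r.N : ℝ) - (r.ρ (plaquetteHolonomy U (Pi.single (2 : Fin 4) (((2 * k) : ℕ) : ZMod (16 * k))) 0 1)).trace.re)) - wilsonExpectation r.ρ β (fun U : GaugeConfig 4 (16 * k) G => (r.N : ℝ) - (r.ρ (plaquetteHolonomy U 0 0 1)).trace.re) * wilsonExpectation r.ρ β (fun U : GaugeConfig 4 (16 * k) G => (r.N : ℝ) - (r.ρ (plaquetteHolonomy U (Pi.single (2 : Fin 4) (((2 * k) : ℕ) : ZMod (16 * k))) 0 1)).trace.re)) / (wilsonExpectation r.ρ β (fun U : GaugeConfig 4 (16 * k) G => ((r.N : ℝ) - (r.ρ (plaquetteHolonomy U 0 0 1)).trace.re) * ((r.N : ℝ) - (r.ρ (plaquetteHolonomy U (Pi.single (2 : Fin 4) ((k : ℕ) : ZMod (16 * k))) 0 1)).trace.re)) - wilsonExpectation r.ρ β (fun U : GaugeConfig 4 (16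 * k) G => (r.N : ℝ) - (r.ρ (plaquetteHolonomy U 0 0 1)).trace.re) * wilsonExpectation r.ρ β (fun U : GaugeConfig 4 (16 * k) G => (r.N : ℝ) - (r.ρ (plaquetteHolonomy U (Pi.single (2 : Fin 4) ((k : ℕ) : ZMod (16 * k))) 0 1)).trace.re)) :=
  Summit.QuantumFields.YangMills.Theorems.LatticeGapInUVUnitsC.AmplitudeRatchet.stub_ratioSeed

/-- **Stub S2 — BOUND** — LANDED p122942 (`Theorems/LangevinControlUVLatticeGapInUVUnitsCStubRatioBound.lean`). (Reflection positivity.)  On every torus `(ℤ/16k)⁴`, every `β ≥ 0`: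
`Cov(P_0, P_{2k e₂}) / Cov(P_0, P_{k e₂}) ≤ 1` — the axis profile is non-negative and non-increasing on `[0, L/2]`
(tree `FemtoCurvatureTwoPoint.AxisCovNonneg.axisPlaquetteCov_nonneg` / `axisPlaquetteCov_antitone`; `x/0 = 0`). -/
theorem stub_ratioBound : ∀ (G : Type) [Group G] [TopologicalSpace G] [IsTopologicalGroup G] [CompactSpace G] [MeasurableSpace G] [BorelSpace G] (r : LatticeRep G) (β : ℝ), 0 ≤ β → ∀ (k : ℕ) [NeZero (16 * k)], (wilsonExpectation r.ρ β (fun U : GaugeConfig 4 (16 * k) G => ((r.N : ℝ) - (r.ρ (plaquetteHolonomy U 0 0 1)).trace.re) * ((r.N : ℝ) - (r.ρ (plaquetteHolonomy U (Pi.single (2 : Fin 4) (((2 * k) : ℕ) : ZMod (16 * k))) 0 1)).trace.re)) - wilsonExpectation r.ρ β (fun U : GaugeConfig 4 (16 * k) G => (r.N : ℝ) - (r.ρ (plaquetteHolonomy U 0 0 1)).trace.re) * wilsonExpectation r.ρ β (fun U : GaugeConfig 4 (16 * k) G => (r.N : ℝ) - (r.ρ (plaquetteHolonomy U (Pi.single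 (2 : Fin 4) (((2 * k) : ℕ) : ZMod (16 * k))) 0 1)).trace.re)) / (wilsonExpectation r.ρ β (fun U : GaugeConfig 4 (16 * k) G => ((r.N : ℝ) - (r.ρ (plaquetteHolonomy U 0 0 1)).trace.re) * ((r.N : ℝ) - (r.ρ (plaquetteHolonomy U (Pi.single (2 : Fin 4) ((k : ℕ) : ZMod (16 * k))) 0 1)).trace.re)) - wilsonExpectation r.ρ β (fun U : GaugeConfig 4 (16 * k) G => (r.N : ℝ) - (r.ρ (plaquetteHolonomy U 0 0 1)).trace.re) * wilsonExpectation r.ρ β (fun U : GaugeConfig 4 (16 * k) G => (r.N : ℝ) - (r.ρ (plaquetteHolonomy U (Pi.single (2 : Fin 4) ((k : ℕ) : ZMod (16 * k))) 0 1)).trace.re)) ≤ 1 :=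
  Summit.QuantumFields.YangMills.Theorems.LatticeGapInUVUnitsC.AmplitudeRatchet.stub_ratioBound

/-- **Stub S4 — WINDOWED DICHOTOMY** (open physics, HARDEST — the line's one bet).  For compact simple `G` and a
continuous unit map with the package there are `δ, γ > 0`, `K`, `β₂` and a window of `M` octaves such that for
`β ≥ β₂` and every `k` at or beyond the femto edge (`ℓ₀ ≤ 32 k a β`), EITHER the ratio grows by the factor `1 + δ`
over the window (read on the tori of sides `16k` and `16·2^M k`), OR the overlapping block heat bath with SOME nominal
cell `b ≤ 16·2^M k` (any cell not larger than the side of the torus on which the ratio stalled) satisfies the global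
Poincaré inequality with constant `γ` on gauge-invariant functions on every torus of side `2S+1`, `S ≥ K·16·2^M k`
(the Knabe certificate of `…KnabeBlockSampler` at a LOCATED scale).  The flexible cell makes this stub a CONSEQUENCE of
the knabe line's promoted certificate in its global form (`stub_ratioDichotomy_of_globalCertificate` below, proved):
the ratchet only adds freedom (growth may replace the certificate in any window). -/
theorem stub_ratioDichotomy : ∀ (G : Type) [Group G] [TopologicalSpace G] [IsTopologicalGroup G] [CompactSpace G] [MeasurableSpace G] [BorelSpace G] (r : LatticeRep G) (a Γ : ℝ → ℝ) (β₀ ℓ₀ c C : ℝ), IsCompactSimpleLieGroup G → Continuous a → 0 < ℓ₀ → 0 < c → (∀ β, 0 < a β) → Filter.Tendsto a Filter.atTop (nhds 0) → (∀ s : ℝ, 0 < s → s ≤ ℓ₀ → 0 < Γ s ∧ Γ s ≤ 1) → (∀ (L : ℕ) [NeZero L] (β : ℝ), β₀ ≤ β → (L : ℝ) * a β ≤ ℓ₀ → let P : (Fin 4 → ZMod L) → Fin 4 → Fin 4 → GaugeConfig 4 L G → ℝ := fun x i j U => (r.N : ℝ) - (r.ρ (plaquetteHolonomy U x i j)).trace.re;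 let E : (GaugeConfig 4 L G → ℝ) → ℝ := fun F => wilsonExpectation (d := 4) (L := L) r.ρ β F; let cov : (GaugeConfig 4 L G → ℝ) → (GaugeConfig 4 L G → ℝ) → ℝ := fun F F' => E (fun U => F U * F' U) - E F * E F'; let dist : (Fin 4 → ZMod L) → (Fin 4 → ZMod L) → ℝ := fun x y => Real.sqrt (∑ k : Fin 4, (((x k - y k).valMinAbs : ℤ) : ℝ) ^ 2); (∀ n : ℕ, 1 ≤ n → 8 * n ≤ L → c * Γ ((n : ℝ) * a β) ≤ (n : ℝ) ^ 8 * cov (P 0 0 1) (P (Pi.single (2 : Fin 4) ((n : ℕ) : ZMod L)) 0 1) ∧ (n : ℝ) ^ 8 * cov (P 0 0 1) (P (Pi.single (2 : Fin 4) ((n : ℕ) : ZMod L)) 0 1) ≤ C * Γ ((n : ℝ) * a β)) ∧ (∀ (x y : Fin 4 → ZMod L) (i j i' j' : Fin 4), x ≠ y → i ≠ j → i' ≠ j' → |cov (P x i j) (P y i' j')| * dist x y ^ 8 ≤ C * Γ (dist x y * a β))) → ∃ (δ γ K β₂ : ℝ) (M : ℕ), 0 < δ ∧ 0 < γ ∧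 ∀ β : ℝ, β₂ ≤ β → ∀ (k : ℕ) [NeZero (16 * k)] [NeZero (16 * (2 ^ M * k))], ℓ₀ ≤ 32 * ((k : ℝ) * a β) → (1 + δ) * ((wilsonExpectation r.ρ β (fun U : GaugeConfig 4 (16 * k) G => ((r.N : ℝ) - (r.ρ (plaquetteHolonomy U 0 0 1)).trace.re) * ((r.N : ℝ) - (r.ρ (plaquetteHolonomy U (Pi.single (2 : Fin 4) (((2 * k) : ℕ) : ZMod (16 * k))) 0 1)).trace.re)) - wilsonExpectation r.ρ β (fun U : GaugeConfig 4 (16 * k) G => (r.N : ℝ) - (r.ρ (plaquetteHolonomy U 0 0 1)).trace.re) * wilsonExpectation r.ρ β (fun U : GaugeConfig 4 (16 * k) G => (r.N : ℝ) - (r.ρ (plaquetteHolonomy U (Pi.single (2 : Fin 4) (((2 * k) : ℕ) : ZMod (16 * k))) 0 1)).trace.re)) / (wilsonExpectation r.ρ β (fun U : GaugeConfig 4 (16 * k) G => ((r.N : ℝ) - (r.ρ (plaquetteHolonomy U 0 0 1)).trace.re) * ((r.N : ℝ) - (r.ρ (plaquetteHolonomy U (Pi.single (2 : Fin 4) ((k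 : ℕ) : ZMod (16 * k))) 0 1)).trace.re)) - wilsonExpectation r.ρ β (fun U : GaugeConfig 4 (16 * k) G => (r.N : ℝ) - (r.ρ (plaquetteHolonomy U 0 0 1)).trace.re) * wilsonExpectation r.ρ β (fun U : GaugeConfig 4 (16 * k) G => (r.N : ℝ) - (r.ρ (plaquetteHolonomy U (Pi.single (2 : Fin 4) ((k : ℕ) : ZMod (16 * k))) 0 1)).trace.re))) ≤ (wilsonExpectation r.ρ β (fun U : GaugeConfig 4 (16 * (2 ^ M * k)) G => ((r.N : ℝ) - (r.ρ (plaquetteHolonomy U 0 0 1)).trace.re) * ((r.N : ℝ) - (r.ρ (plaquetteHolonomy U (Pi.single (2 : Fin 4) (((2 * (2 ^ M * k)) : ℕ) : ZMod (16 * (2 ^ M * k)))) 0 1)).trace.re)) - wilsonExpectation r.ρ β (fun U : GaugeConfig 4 (16 * (2 ^ M * k)) G => (r.N : ℝ) - (r.ρ (plaquetteHolonomy U 0 0 1)).trace.re) * wilsonExpectation r.ρ β (fun U : GaugeConfig 4 (16 * (2 ^ M * k)) G => (r.N : ℝ) - (r.ρ (plaquetteHolonomy U (Pi.single (2 : Fin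 4) (((2 * (2 ^ M * k)) : ℕ) : ZMod (16 * (2 ^ M * k)))) 0 1)).trace.re)) / (wilsonExpectation r.ρ β (fun U : GaugeConfig 4 (16 * (2 ^ M * k)) G => ((r.N : ℝ) - (r.ρ (plaquetteHolonomy U 0 0 1)).trace.re) * ((r.N : ℝ) - (r.ρ (plaquetteHolonomy U (Pi.single (2 : Fin 4) (((2 ^ M * k) : ℕ) : ZMod (16 * (2 ^ M * k)))) 0 1)).trace.re)) - wilsonExpectation r.ρ β (fun U : GaugeConfig 4 (16 * (2 ^ M * k)) G => (r.N : ℝ) - (r.ρ (plaquetteHolonomy U 0 0 1)).trace.re) * wilsonExpectation r.ρ β (fun U : GaugeConfig 4 (16 * (2 ^ M * k)) G => (r.N : ℝ) - (r.ρ (plaquetteHolonomy U (Pi.single (2 : Fin 4) (((2 ^ M * k) : ℕ) : ZMod (16 * (2 ^ M * k)))) 0 1)).trace.re)) ∨ ∃ b : ℕ, 1 ≤ b ∧ b ≤ 16 * (2 ^ M * k) ∧ ∀ S : ℕ, K * (((16 * (2 ^ M * k) : ℕ)) : ℝ) ≤ S → GlobalPoincare r.ρ β (2 * S + 1) b γ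 := by
  sorry

/-! ## §5 The composition: the crux BY NAME from S1, S2, S4 and the landed Knabe pipeline -/

/-- **The skeleton theorem.**  `LatticeGapInUVUnitsC` from `stub_ratioSeed`, `stub_ratioBound`, `stub_ratioDichotomy`
and the landed `stub_gapToClustering stub_spectralToolkit.2 stub_lightCone`: ladder `k_j(β) = 2^{Mj} ⌊ℓ₀/(16 a β)⌋` from
the femto edge (`β` beyond `max 0 β₀ β₂` and beyond the coupling where `a < ℓ₀/32`), `J` from `exists_window_count`,
`concl_of_ratchet` with certificate `Cert β n :=` "global Poincaré at cell `16 n` on all tori `S ≥ K·16 n`". -/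
theorem LatticeGapInUVUnitsC_of : LatticeGapInUVUnitsC := by
  intro G _ _ _ _ hG
  letI : MeasurableSpace G := borel G
  haveI : BorelSpace G := ⟨rfl⟩
  intro r a ha hP
  obtain ⟨Γ, β₀, ℓ₀, c, C, hℓ₀, hc, hpos, hlim, hΓ, hbox⟩ := hP
  obtain ⟨vmin, hvmin, hseed⟩ := stub_ratioSeed G r a Γ β₀ ℓ₀ c C ha hℓ₀ hc hpos hlim hΓ hbox
  have hbound := stub_ratioBound G r
  obtain ⟨δ, γ, K, β₂, M, hδ, hγ, hdich⟩ := stub_ratioDichotomy G r a Γ β₀ ℓ₀ c C hG ha hℓ₀ hc hpos hlim hΓ hbox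
  obtain ⟨ρ, hρ, hpipe⟩ :=
    Summit.QuantumFields.YangMills.Theorems.LatticeGapInUVUnits.KnabeBlockSampler.stub_gapToClustering
      Summit.QuantumFields.YangMills.Theorems.LatticeGapInUVUnits.KnabeBlockSampler.stub_spectralToolkit.2
      Summit.QuantumFields.YangMills.Theorems.LatticeGapInUVUnits.KnabeBlockSampler.stub_lightCone G r γ hγ
  obtain ⟨J, hJ⟩ := exists_window_count 1 hvmin hδ
  -- couplings beyond which `a β < ℓ₀ / 32`
  have h32 : (0 : ℝ) < ℓ₀ / 32 := by positivity
  obtain ⟨β₃, hβ₃⟩ := Filter.eventually_atTop.1 (hlim (Iio_mem_nhds h32))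
  set βs : ℝ := max (max 0 β₀) (max β₂ β₃) with hβs
  have h0_le : ∀ β, βs ≤ β → 0 ≤ β := fun β h => le_trans (le_max_left _ _ |>.trans' (le_max_left _ _)) h
  have hβ₀_le : ∀ β, βs ≤ β → β₀ ≤ β := fun β h => le_trans (le_max_left _ _ |>.trans' (le_max_right _ _)) h
  have hβ₂_le : ∀ β, βs ≤ β → β₂ ≤ β := fun β h => le_trans (le_max_right _ _ |>.trans' (le_max_left _ _)) h
  have hβ₃_le : ∀ β, βs ≤ β → β₃ ≤ β := fun β h => le_trans (le_max_right _ _ |>.trans' (le_max_right _ _)) h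
  -- the femto-edge scale `k₀ β = ⌊ℓ₀ / (16 a β)⌋`
  set k₀ : ℝ → ℕ := fun β => ⌊ℓ₀ / (16 * a β)⌋₊ with hk₀
  have ha32 : ∀ β, βs ≤ β → a β < ℓ₀ / 32 := fun β h => hβ₃ β (hβ₃_le β h)
  have hk₀le : ∀ β, βs ≤ β → 16 * ((k₀ β : ℝ) * a β) ≤ ℓ₀ := by
    intro β hβ
    have h1 : (k₀ β : ℝ) ≤ ℓ₀ / (16 * a β) :=
      Nat.floor_le (div_pos hℓ₀ (mul_pos (by norm_num) (hpos β))).le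
    have h2 : (k₀ β : ℝ) * a β ≤ ℓ₀ / (16 * a β) * a β := mul_le_mul_of_nonneg_right h1 (hpos β).le
    have h3 : ℓ₀ / (16 * a β) * a β = ℓ₀ / 16 := by
      have hne := (hpos β).ne'
      field_simp
    linarith
  have hk₀ge : ∀ β, βs ≤ β → ℓ₀ ≤ 32 * ((k₀ β : ℝ) * a β) := by
    intro β hβ
    have h1 : ℓ₀ / (16 * a β) < (k₀ β : ℝ) + 1 := Nat.lt_floor_add_one _
    have h2 : ℓ₀ / (16 * a β) * a β < ((k₀ β : ℝ) + 1) * a β := mul_lt_mul_of_pos_right h1 (hpos β)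
    have h3 : ℓ₀ / (16 * a β) * a β = ℓ₀ / 16 := by
      have hne := (hpos β).ne'
      field_simp
    have h4 := ha32 β hβ
    nlinarith
  have hk₀pos : ∀ β, βs ≤ β → 1 ≤ k₀ β := by
    intro β hβ
    by_contra h0
    have h0' : k₀ β = 0 := by omega
    have := hk₀ge β hβ
    rw [h0'] at this
    simp at this
    linarith
  -- ladder arithmetic
  have hpow : ∀ (β : ℝ) (j : ℕ), 2 ^ M * (2 ^ (M * j) * k₀ β) = 2 ^ (M * (j + 1)) * k₀ β := by
    intro β j; rw [Nat.mul_succ, pow_add]; ring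
  have hladder_ne : ∀ β, βs ≤ β → ∀ j : ℕ, 2 ^ (M * j) * k₀ β ≠ 0 := fun β hβ j =>
    (Nat.mul_pos (pow_pos (by norm_num) _) (hk₀pos β hβ)).ne'
  have hladder_edge : ∀ β, βs ≤ β → ∀ j : ℕ, ℓ₀ ≤ 32 * (((2 ^ (M * j) * k₀ β : ℕ) : ℝ) * a β) := by
    intro β hβ j
    have h1 := hk₀ge β hβ
    have h2 : (k₀ β : ℝ) ≤ ((2 ^ (M * j) * k₀ β : ℕ) : ℝ) := by
      exact_mod_cast Nat.le_mul_of_pos_left (k₀ β) (pow_pos (by norm_num) _)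
    have h3 := mul_le_mul_of_nonneg_right h2 (hpos β).le
    linarith
  -- the generic ratchet, fed with the three stubs and the landed pipeline (certificate at cell `16 n`)
  refine concl_of_ratchet r hpos (axisRatio r)
    (fun β n => ∃ b : ℕ, 1 ≤ b ∧ b ≤ 16 * n ∧
      ∀ S : ℕ, K * (((16 * n : ℕ)) : ℝ) ≤ S → GlobalPoincare r.ρ β (2 * S + 1) b γ)
    (ℓ := ℓ₀ / 16) (β₂ := βs) (umin := vmin) (U := 1) (K := 16 * max K 0) (c := ρ / 16)
    hδ.le (by positivity) (by positivity) k₀ hk₀pos ?_ M J hJ ?_ ?_ ?_ ?_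
  · -- femto edge: `k₀ β · a β ≤ ℓ₀ / 16`
    intro β hβ
    have := hk₀le β hβ
    linarith
  · -- SEED (S1)
    intro β hβ
    haveI : NeZero (16 * k₀ β) := ⟨by have := hk₀pos β hβ; omega⟩
    rw [axisRatio_eq r β (k₀ β) (by have := hk₀pos β hβ; omega)]
    exact hseed β (hβ₀_le β hβ) (k₀ β) (hk₀ge β hβ) (hk₀le β hβ)
  · -- BOUND (S2)
    intro β hβ j _
    have hne := hladder_ne β hβ j
    haveI : NeZero (16 * (2 ^ (M * j) * k₀ β)) := ⟨by omega⟩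
    rw [axisRatio_eq r β _ hne]
    exact hbound β (h0_le β hβ) _
  · -- DICHOTOMY (S4)
    intro β hβ j _
    have hne := hladder_ne β hβ j
    have hne' : 2 ^ M * (2 ^ (M * j) * k₀ β) ≠ 0 :=
      (Nat.mul_pos (pow_pos (by norm_num) _) (Nat.pos_of_ne_zero hne)).ne'
    haveI : NeZero (16 * (2 ^ (M * j) * k₀ β)) := ⟨by omega⟩
    haveI : NeZero (16 * (2 ^ M * (2 ^ (M * j) * k₀ β))) := ⟨by omega⟩
    rw [← hpow β j]
    rcases hdich β (hβ₂_le β hβ) (2 ^ (M * j) * k₀ β) (hladder_edge β hβ j) with hgrow | hcert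
    · left
      rw [axisRatio_eq r β _ hne, axisRatio_eq r β _ hne']
      exact hgrow
    · right
      exact hcert
  · -- PIPELINE (landed `stub_gapToClustering`, at the certified cell `b ≤ 16 n`)
    intro A B
    obtain ⟨C', hC'⟩ := hpipe A B
    refine ⟨max C' 0, fun β _ n hn hCert S n' hKS hn' => ?_⟩
    obtain ⟨b, hb1, hb16, hGP⟩ := hCert
    have hKS' : K * (((16 * n : ℕ)) : ℝ) ≤ S := by
      have h1 : K * (((16 * n : ℕ)) : ℝ) ≤ max K 0 * (((16 * n : ℕ)) : ℝ) :=
        mul_le_mul_of_nonneg_right (le_max_left _ _) (by positivity)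
      have h2 : max K 0 * (((16 * n : ℕ)) : ℝ) = 16 * max K 0 * (n : ℝ) := by push_cast; ring
      linarith
    have h := hC' β b S n' hb1 hn' (hGP S hKS')
    -- a smaller cell only improves the rate: `ρ n'/b ≥ (ρ/16) n'/n` since `b ≤ 16 n`
    have hbpos : (0 : ℝ) < b := by exact_mod_cast hb1
    have hnpos : (0 : ℝ) < n := by exact_mod_cast hn
    have key : ρ / 16 * (n' : ℝ) / (n : ℝ) ≤ ρ * (n' : ℝ) / (b : ℝ) := by
      rw [div_le_div_iff₀ hnpos hbpos]
      have hb16' : (b : ℝ) ≤ 16 * (n : ℝ) := by exact_mod_cast hb16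
      have hn'0 : (0 : ℝ) ≤ n' := Nat.cast_nonneg n'
      nlinarith [mul_le_mul_of_nonneg_left hb16' (mul_nonneg hρ.le hn'0)]
    calc |latticeConnectedCorr r.ρ β (2 * S + 1) A.F B.F n'| ≤ C' * Real.exp (-(ρ * n' / b)) := h
      _ ≤ max C' 0 * Real.exp (-(ρ * n' / b)) :=
          mul_le_mul_of_nonneg_right (le_max_left _ _) (Real.exp_pos _).le
      _ ≤ max C' 0 * Real.exp (-(ρ / 16 * n' / n)) :=
          mul_le_mul_of_nonneg_left (Real.exp_le_exp.2 (neg_le_neg key)) (le_max_right _ _)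

/-! ## §6 The open stub is implied by the knabe line's promoted certificate (global form) — documented, proved -/

/-- **`stub_ratioDichotomy` from ONE global block-sampler certificate at cell `⌈K₀/a β⌉`.**  If for `β ≥ β₂` the
overlapping block heat bath at the physical cell `K₀` (nominal cell `⌈K₀/a β⌉`) satisfies the global Poincaré
inequality with constant `γ` on all tori `S ≥ K ⌈K₀/a β⌉` — the knabe line's promoted `stub_blockSamplerCertificate`
after the landed transcription `stub_samplerTranscription`, i.e. the mass gap at ONE physical scale — then the windowed
dichotomy holds with the certificate branch in EVERY window: choose `M` with `2^M ℓ₀ ≥ 4 K₀`, so that the end torus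
`16·2^M k ≥ 2^{M-1} ℓ₀ / a β ≥ ⌈K₀/a β⌉` of every window at or beyond the femto edge already contains the certified cell.
So the ratchet's open stub is AT MOST as strong as the knabe line's; the growth branch is pure added freedom. -/
theorem stub_ratioDichotomy_of_globalCertificate (hcert : ∀ (G : Type) [Group G] [TopologicalSpace G] [IsTopologicalGroup G] [CompactSpace G] [MeasurableSpace G] [BorelSpace G] (r : LatticeRep G) (a Γ : ℝ → ℝ) (β₀ ℓ₀ c C : ℝ), IsCompactSimpleLieGroup G → Continuous a → 0 < ℓ₀ → 0 < c → (∀ β, 0 < a β) → Filter.Tendsto a Filter.atTop (nhds 0) → (∀ s : ℝ, 0 < s → s ≤ ℓ₀ → 0 < Γ s ∧ Γ s ≤ 1) → (∀ (L : ℕ) [NeZero L] (β : ℝ), β₀ ≤ β → (L : ℝ) * a β ≤ ℓ₀ → let P : (Fin 4 → ZMod L) → Fin 4 → Fin 4 → GaugeConfig 4 L G → ℝ := fun x i j U => (r.N : ℝ) - (r.ρ (plaquetteHolonomy U x i j)).trace.re; let E : (GaugeConfig 4 L G → ℝ) → ℝ := fun F => wilsonExpectation (d := 4) (L := L) r.ρ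 β F; let cov : (GaugeConfig 4 L G → ℝ) → (GaugeConfig 4 L G → ℝ) → ℝ := fun F F' => E (fun U => F U * F' U) - E F * E F'; let dist : (Fin 4 → ZMod L) → (Fin 4 → ZMod L) → ℝ := fun x y => Real.sqrt (∑ k : Fin 4, (((x k - y k).valMinAbs : ℤ) : ℝ) ^ 2); (∀ n : ℕ, 1 ≤ n → 8 * n ≤ L → c * Γ ((n : ℝ) * a β) ≤ (n : ℝ) ^ 8 * cov (P 0 0 1) (P (Pi.single (2 : Fin 4) ((n : ℕ) : ZMod L)) 0 1) ∧ (n : ℝ) ^ 8 * cov (P 0 0 1) (P (Pi.single (2 : Fin 4) ((n : ℕ) : ZMod L)) 0 1) ≤ C * Γ ((n : ℝ) * a β)) ∧ (∀ (x y : Fin 4 → ZMod L) (i j i' j' : Fin 4), x ≠ y → i ≠ j → i' ≠ j' → |cov (P x i j) (P y i' j')| * dist x y ^ 8 ≤ C * Γ (dist x y * a β))) → ∃ (K₀ γ K β₂ : ℝ), 0 < K₀ ∧ 0 < γ ∧ ∀ β : ℝ, β₂ ≤ β → ∀ S : ℕ, K * (⌈K₀ / a β⌉₊ : ℝ) ≤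 S → GlobalPoincare r.ρ β (2 * S + 1) ⌈K₀ / a β⌉₊ γ) : ∀ (G : Type) [Group G] [TopologicalSpace G] [IsTopologicalGroup G] [CompactSpace G] [MeasurableSpace G] [BorelSpace G] (r : LatticeRep G) (a Γ : ℝ → ℝ) (β₀ ℓ₀ c C : ℝ), IsCompactSimpleLieGroup G → Continuous a → 0 < ℓ₀ → 0 < c → (∀ β, 0 < a β) → Filter.Tendsto a Filter.atTop (nhds 0) → (∀ s : ℝ, 0 < s → s ≤ ℓ₀ → 0 < Γ s ∧ Γ s ≤ 1) → (∀ (L : ℕ) [NeZero L] (β : ℝ), β₀ ≤ β → (L : ℝ) * a β ≤ ℓ₀ → let P : (Fin 4 → ZMod L) → Fin 4 → Fin 4 → GaugeConfig 4 L G → ℝ := fun x i j U => (r.N : ℝ) - (r.ρ (plaquetteHolonomy U x i j)).trace.re; let E : (GaugeConfig 4 L G → ℝ) → ℝ := fun F => wilsonExpectation (d := 4) (L := L) r.ρ β F; let cov : (GaugeConfig 4 L G → ℝ) → (GaugeConfig 4 L G → ℝ) → ℝ := fun F F' => E (fun U => F U * F' U) - E F * E F'; let dist : (Fin 4 → ZMod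 L) → (Fin 4 → ZMod L) → ℝ := fun x y => Real.sqrt (∑ k : Fin 4, (((x k - y k).valMinAbs : ℤ) : ℝ) ^ 2); (∀ n : ℕ, 1 ≤ n → 8 * n ≤ L → c * Γ ((n : ℝ) * a β) ≤ (n : ℝ) ^ 8 * cov (P 0 0 1) (P (Pi.single (2 : Fin 4) ((n : ℕ) : ZMod L)) 0 1) ∧ (n : ℝ) ^ 8 * cov (P 0 0 1) (P (Pi.single (2 : Fin 4) ((n : ℕ) : ZMod L)) 0 1) ≤ C * Γ ((n : ℝ) * a β)) ∧ (∀ (x y : Fin 4 → ZMod L) (i j i' j' : Fin 4), x ≠ y → i ≠ j → i' ≠ j' → |cov (P x i j) (P y i' j')| * dist x y ^ 8 ≤ C * Γ (dist x y * a β))) → ∃ (δ γ K β₂ : ℝ) (M : ℕ), 0 < δ ∧ 0 < γ ∧ ∀ β : ℝ, β₂ ≤ β → ∀ (k : ℕ) [NeZero (16 * k)] [NeZero (16 * (2 ^ M * k))], ℓ₀ ≤ 32 * ((k : ℝ) * a β) → (1 + δ) * ((wilsonExpectation r.ρ β (fun U : GaugeConfig 4 (16 * k) G => ((r.N : ℝ)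 - (r.ρ (plaquetteHolonomy U 0 0 1)).trace.re) * ((r.N : ℝ) - (r.ρ (plaquetteHolonomy U (Pi.single (2 : Fin 4) (((2 * k) : ℕ) : ZMod (16 * k))) 0 1)).trace.re)) - wilsonExpectation r.ρ β (fun U : GaugeConfig 4 (16 * k) G => (r.N : ℝ) - (r.ρ (plaquetteHolonomy U 0 0 1)).trace.re) * wilsonExpectation r.ρ β (fun U : GaugeConfig 4 (16 * k) G => (r.N : ℝ) - (r.ρ (plaquetteHolonomy U (Pi.single (2 : Fin 4) (((2 * k) : ℕ) : ZMod (16 * k))) 0 1)).trace.re)) / (wilsonExpectation r.ρ β (fun U : GaugeConfig 4 (16 * k) G => ((r.N : ℝ) - (r.ρ (plaquetteHolonomy U 0 0 1)).trace.re) * ((r.N : ℝ) - (r.ρ (plaquetteHolonomy U (Pi.single (2 : Fin 4) ((k : ℕ) : ZMod (16 * k))) 0 1)).trace.re)) - wilsonExpectation r.ρ β (fun U : GaugeConfig 4 (16 * k) G => (r.N : ℝ) - (r.ρ (plaquetteHolonomy U 0 0 1)).trace.re) * wilsonExpectation r.ρ β (fun U : GaugeConfig 4 (16 * k) G => (r.N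 : ℝ) - (r.ρ (plaquetteHolonomy U (Pi.single (2 : Fin 4) ((k : ℕ) : ZMod (16 * k))) 0 1)).trace.re))) ≤ (wilsonExpectation r.ρ β (fun U : GaugeConfig 4 (16 * (2 ^ M * k)) G => ((r.N : ℝ) - (r.ρ (plaquetteHolonomy U 0 0 1)).trace.re) * ((r.N : ℝ) - (r.ρ (plaquetteHolonomy U (Pi.single (2 : Fin 4) (((2 * (2 ^ M * k)) : ℕ) : ZMod (16 * (2 ^ M * k)))) 0 1)).trace.re)) - wilsonExpectation r.ρ β (fun U : GaugeConfig 4 (16 * (2 ^ M * k)) G => (r.N : ℝ) - (r.ρ (plaquetteHolonomy U 0 0 1)).trace.re) * wilsonExpectation r.ρ β (fun U : GaugeConfig 4 (16 * (2 ^ M * k)) G => (r.N : ℝ) - (r.ρ (plaquetteHolonomy U (Pi.single (2 : Fin 4) (((2 * (2 ^ M * k)) : ℕ) : ZMod (16 * (2 ^ M * k)))) 0 1)).trace.re)) / (wilsonExpectation r.ρ β (fun U : GaugeConfig 4 (16 * (2 ^ M * k)) G => ((r.N : ℝ) - (r.ρ (plaquetteHolonomy U 0 0 1)).trace.re) * ((r.N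 : ℝ) - (r.ρ (plaquetteHolonomy U (Pi.single (2 : Fin 4) (((2 ^ M * k) : ℕ) : ZMod (16 * (2 ^ M * k)))) 0 1)).trace.re)) - wilsonExpectation r.ρ β (fun U : GaugeConfig 4 (16 * (2 ^ M * k)) G => (r.N : ℝ) - (r.ρ (plaquetteHolonomy U 0 0 1)).trace.re) * wilsonExpectation r.ρ β (fun U : GaugeConfig 4 (16 * (2 ^ M * k)) G => (r.N : ℝ) - (r.ρ (plaquetteHolonomy U (Pi.single (2 : Fin 4) (((2 ^ M * k) : ℕ) : ZMod (16 * (2 ^ M * k)))) 0 1)).trace.re)) ∨ ∃ b : ℕ, 1 ≤ b ∧ b ≤ 16 * (2 ^ M * k) ∧ ∀ S : ℕ, K * (((16 * (2 ^ M * k) : ℕ)) : ℝ) ≤ S → GlobalPoincare r.ρ β (2 * S + 1) b γ := by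
  intro G _ _ _ _ _ _ r a Γ β₀ ℓ₀ c C hG ha hℓ₀ hc hpos hlim hΓ hbox
  obtain ⟨K₀, γ, K, β₂, hK₀, hγ, hGP⟩ := hcert G r a Γ β₀ ℓ₀ c C hG ha hℓ₀ hc hpos hlim hΓ hbox
  -- the window length: `2^M ℓ₀ ≥ 4 K₀`
  obtain ⟨M, hM⟩ := pow_unbounded_of_one_lt (4 * K₀ / ℓ₀) (by norm_num : (1 : ℝ) < 2)
  -- couplings beyond which `a β ≤ K₀` (so that `⌈K₀/a β⌉ ≤ 2 K₀ / a β`)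
  obtain ⟨β₃, hβ₃⟩ := Filter.eventually_atTop.1 (hlim (Iio_mem_nhds hK₀))
  refine ⟨1, γ, max K 0, max β₂ β₃, M, one_pos, hγ, fun β hβ k _ _ hk => Or.inr ?_⟩
  have hβ₂ : β₂ ≤ β := (le_max_left _ _).trans hβ
  have haK : a β < K₀ := hβ₃ β ((le_max_right _ _).trans hβ)
  have hKa : 0 < K₀ / a β := div_pos hK₀ (hpos β)
  refine ⟨⌈K₀ / a β⌉₊, Nat.one_le_iff_ne_zero.2 (Nat.ceil_pos.2 hKa).ne', ?_, fun S hS => hGP β hβ₂ S ?_⟩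
  · -- `⌈K₀/a β⌉ ≤ 16 · 2^M · k` because `2 K₀ ≤ 2^{M-1} ℓ₀ ≤ 16 · 2^M · k · a β`
    have h1 : ((⌈K₀ / a β⌉₊ : ℕ) : ℝ) < K₀ / a β + 1 := Nat.ceil_lt_add_one hKa.le
    have h2 : (K₀ / a β + 1) * a β = K₀ + a β := by
      rw [add_mul, one_mul, div_mul_cancel₀ K₀ (hpos β).ne']
    have h3 : ((⌈K₀ / a β⌉₊ : ℕ) : ℝ) * a β < 2 * K₀ := by
      have := mul_lt_mul_of_pos_right h1 (hpos β)
      linarith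
    have hM' : 4 * K₀ < 2 ^ M * ℓ₀ := by rwa [div_lt_iff₀ hℓ₀] at hM
    have h4 : 2 ^ M * ℓ₀ ≤ 32 * (2 ^ M * ((k : ℝ) * a β)) := by
      have := mul_le_mul_of_nonneg_left hk (by positivity : (0 : ℝ) ≤ 2 ^ M)
      linarith
    have h5 : ((⌈K₀ / a β⌉₊ : ℕ) : ℝ) * a β < ((16 * (2 ^ M * k) : ℕ) : ℝ) * a β := by
      push_cast
      nlinarith [hpos β]
    exact_mod_cast (lt_of_mul_lt_mul_right h5 (hpos β).le).le
  · -- torus condition: `K ⌈K₀/a β⌉ ≤ max K 0 · (16 · 2^M k) ≤ S`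
    have hb : ((⌈K₀ / a β⌉₊ : ℕ) : ℝ) ≤ ((16 * (2 ^ M * k) : ℕ) : ℝ) := by
      -- same comparison as above, non-strict
      have h1 : ((⌈K₀ / a β⌉₊ : ℕ) : ℝ) < K₀ / a β + 1 := Nat.ceil_lt_add_one hKa.le
      have h3 : ((⌈K₀ / a β⌉₊ : ℕ) : ℝ) * a β < 2 * K₀ := by
        have := mul_lt_mul_of_pos_right h1 (hpos β)
        have h2 : (K₀ / a β + 1) * a β = K₀ + a β := by
          rw [add_mul, one_mul, div_mul_cancel₀ K₀ (hpos β).ne']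
        linarith
      have hM' : 4 * K₀ < 2 ^ M * ℓ₀ := by rwa [div_lt_iff₀ hℓ₀] at hM
      have h4 : 2 ^ M * ℓ₀ ≤ 32 * (2 ^ M * ((k : ℝ) * a β)) := by
        have := mul_le_mul_of_nonneg_left hk (by positivity : (0 : ℝ) ≤ 2 ^ M)
        linarith
      have h5 : ((⌈K₀ / a β⌉₊ : ℕ) : ℝ) * a β ≤ ((16 * (2 ^ M * k) : ℕ) : ℝ) * a β := by
        push_cast
        nlinarith [hpos β]
      exact le_of_mul_le_mul_right h5 (hpos β)
    calc K * ((⌈K₀ / a β⌉₊ : ℕ) : ℝ) ≤ max K 0 * ((⌈K₀ / a β⌉₊ : ℕ) : ℝ) :=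
          mul_le_mul_of_nonneg_right (le_max_left _ _) (by positivity)
      _ ≤ max K 0 * (((16 * (2 ^ M * k) : ℕ)) : ℝ) := mul_le_mul_of_nonneg_left hb (le_max_right _ _)
      _ ≤ S := hS

end Summit.QuantumFields.YangMills.Cruxes.LatticeGapInUVUnitsC.AmplitudeRatchet

end
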